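import Mathlib
import Literature.Computability.AlgebraicComplexity.RazElusiveGeneralProofs
import Summits.ValiantsHypothesis.ValiantsHypothesis.Statement
import Summits.ValiantsHypothesis.ValiantsHypothesis.Theorems.SoloInformedQuadSpanReduction
import Summits.ValiantsHypothesis.ValiantsHypothesis.Theorems.SoloInformedPatternDesign
import HarnessLib

/-!
# Conjecture Q* implies `VP ℂ ≠ VNP ℂ` — all side conditions discharged
(solo seat `solo-ValiantsHypothesis-informed`, s27)

`soloInformed_vp_ne_vnp_of_quadSpanBound_cor58` (file `SoloInformedQuadSpanReduction`) derives
`VP ℂ ≠ VNP ℂ` from a univariate quadratic-span bound structure `B : SoloQuadSpanBound K h`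
(Conjecture Q*, OPEN, carried as a hypothesis) via Raz 2010, Cor. 5.8 — provided explicit
sign-independent designs, parameter functions `r, s`, the eventual inequality
`B.Q (s n) < C(n + r n - 1, r n)` and Raz's Def. 1.3 definability (`hdef`) are supplied.
This file supplies all of them; the only remaining hypothesis is the growth `Q(s) = O(s^γ)`,
`γ < 3/2` (as `ℕ` exponents `Q^b ≤ c s^a`, `2a < 3b`; as a real exponent; as `IsBigO`).
Parameters: `u = ⌊log₂ n⌋`, `τ(n)` = the largest `τ ≤ u` with `W(τ) ≤ u` where
`W(τ) = τ + 2^K + 3(aτ+1) + c((3(aτ+1))!)^b + (6(aτ+1))^{K-1}`; `ρ = aτ+1`, `r = 3ρ`,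
`s = n^{2ρ+τ}`; the design is the subpattern design of `SoloInformedPatternDesign` on the
`⌈log₂ C(n+r-1,r)⌉` index bits when its positions fit into `Fin n` (eventually), else the
singleton design with `r = 1`; both are pattern designs, so Def. 1.3 holds with an empty sum.
Credit: only the implication "Q* ⟹ Valiant's hypothesis over `ℂ`" is claimed; Q* is open
(seat notes `paper/quadspan.md` §2.5, `paper/sharpest.md` §9).
References: R. Raz, Elusive functions and lower bounds for arithmetic circuits, Theory of
Computing 6 (2010) 135–177, Cor. 5.8 (= Cor. 1.14), Defs. 1.1, 1.3 [Raz2010].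
-/

noncomputable section

open MvPolynomial Finset

namespace Summit.ValiantsHypothesis.ValiantsHypothesis.Theorems

open Literature.Computability.AlgebraicComplexity

namespace SoloPattern

/-- The identity pattern design: position `t` tests all `L` bits against the bits of `t`, so that
for indices and positions below `2^L` the sets are the singletons `S i = {i}`. -/
def idPattern (n L : ℕ) : SoloPattern n L where
  P := fun _ => univ
  v := fun t p => (t : ℕ).testBit p

/-- Membership in the sets of the identity pattern (below `2^L`). -/
theorem mem_idPattern_S {n L i : ℕ} {t : Fin n} (hi : i < 2 ^ L) (ht : (t : ℕ) < 2 ^ L) :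
    t ∈ (idPattern n L).S i ↔ (t : ℕ) = i := by
  simp only [mem_S, idPattern, mem_univ, true_implies]
  exact ⟨fun h => (eq_of_testBit_eq_of_lt hi ht h).symm, fun h p => by rw [h]⟩

/-- The identity pattern has private points (to every order) when `m ≤ n ≤ 2^L`. -/
theorem idPattern_privatePoints {n L m K : ℕ} (hm : m ≤ n) (hn : n ≤ 2 ^ L) :
    ∀ T : Finset (Fin m), T.card ≤ K → ∀ i ∈ T,
      ∃ x ∈ (idPattern n L).S i, ∀ j ∈ T, j ≠ i → x ∉ (idPattern n L).S j := by
  intro T _ i _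
  have hi : (i : ℕ) < n := lt_of_lt_of_le i.2 hm
  refine ⟨⟨i, hi⟩, (mem_idPattern_S (n := n) (t := ⟨i, hi⟩) (hi.trans_le hn) (hi.trans_le hn)).2
    rfl, fun j _ hji hx => hji ?_⟩
  have hj : (j : ℕ) < 2 ^ L := (lt_of_lt_of_le j.2 hm).trans_le hn
  exact Fin.ext ((mem_idPattern_S (n := n) (t := ⟨i, hi⟩) hj (hi.trans_le hn)).1 hx).symm

end SoloPattern

/-- `n ≤ C(n + j - 1, j)` for `j ≥ 1`. -/
theorem solo_le_choose_multiset (n : ℕ) : ∀ {j : ℕ}, 1 ≤ j → n ≤ Nat.choose (n + j - 1) j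
  | 0, h => absurd h (by norm_num)
  | 1, _ => by simp
  | j + 1 + 1, _ => by
    calc n ≤ Nat.choose (n + (j + 1) - 1) (j + 1) := solo_le_choose_multiset n (by omega)
      _ ≤ Nat.choose (n + (j + 1) - 1) (j + 1) + Nat.choose (n + (j + 1) - 1) (j + 1 + 1) :=
          Nat.le_add_right _ _
      _ = Nat.choose (n + (j + 1) - 1 + 1) (j + 1 + 1) := (Nat.choose_succ_succ' _ _).symm
      _ = Nat.choose (n + (j + 1 + 1) - 1) (j + 1 + 1) := by
          rw [show n + (j + 1) - 1 + 1 = n + (j + 1 + 1) - 1 by omega]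

/-- `n ^ j ≤ j! · C(n + j - 1, j)` (the rising factorial dominates the power). -/
theorem solo_pow_le_factorial_mul_choose_multiset (n j : ℕ) :
    n ^ j ≤ Nat.factorial j * Nat.choose (n + j - 1) j :=
  (Nat.pow_succ_le_ascFactorial n j).trans_eq (Nat.ascFactorial_eq_factorial_mul_choose' n j)

section Params

variable (K a b c : ℕ)

/-- The threshold weight `W(τ) = τ + 2^K + 3(aτ+1) + c·((3(aτ+1))!)^b + (6(aτ+1))^{K-1}`:
every quantity that has to stay below `log₂ n`. -/
def qsW (τ : ℕ) : ℕ :=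
  τ + 2 ^ K + 3 * (a * τ + 1) + c * Nat.factorial (3 * (a * τ + 1)) ^ b +
    (6 * (a * τ + 1)) ^ (K - 1)

/-- `τ(n)`: the largest `τ ≤ ⌊log₂ n⌋` with `W(τ) ≤ ⌊log₂ n⌋` (and `0` if there is none). -/
def qsTau (n : ℕ) : ℕ :=
  Nat.findGreatest (fun τ => qsW K a b c τ ≤ Nat.log 2 n) (Nat.log 2 n)

/-- `ρ(n) = a·τ(n) + 1`; the rank will be `r = 3ρ`. -/
def qsRho (n : ℕ) : ℕ :=
  a * qsTau K a b c n + 1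

/-- The number of index bits of the arity `C(n + 3ρ - 1, 3ρ)`. -/
def qsL (n : ℕ) : ℕ :=
  Nat.clog 2 (Nat.choose (n + 3 * qsRho K a b c n - 1) (3 * qsRho K a b c n))

/-- The subpattern design fits (a Boolean test): `K - 1 ≤ L` and its `C(L, K-1)·2^{K-1}`
positions fit into `Fin n`. -/
def qsFits (n : ℕ) : Bool :=
  decide (K - 1 ≤ qsL K a b c n) && decide (Nat.choose (qsL K a b c n) (K - 1) * 2 ^ (K - 1) ≤ n)

/-- Unfolding the Boolean test. -/
theorem qsFits_iff (n : ℕ) : qsFits K a b c n = true ↔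
    K - 1 ≤ qsL K a b c n ∧ Nat.choose (qsL K a b c n) (K - 1) * 2 ^ (K - 1) ≤ n := by
  simp [qsFits]

/-- The rank: `r(n) = 3ρ(n)` when the subpattern design fits, else `1`. -/
def qsR (n : ℕ) : ℕ :=
  if qsFits K a b c n then 3 * qsRho K a b c n else 1

/-- The number of algebraic functions: `s(n) = n^{2ρ(n) + τ(n)}`. -/
def qsS (n : ℕ) : ℕ :=
  n ^ (2 * qsRho K a b c n + qsTau K a b c n)

/-- The pattern design along `n`: the subpattern design on the `⌈log₂ C(n+r-1, r)⌉` index bits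
when it fits, the identity pattern otherwise. -/
def qsPattern (n : ℕ) :
    SoloPattern n (Nat.clog 2 (Nat.choose (n + qsR K a b c n - 1) (qsR K a b c n))) :=
  if qsFits K a b c n then SoloPattern.subpattern n _ K else SoloPattern.idPattern n _

/-- The pattern design has private points to order `K` (for every `n`). -/
theorem qsPattern_privatePoints (hK : 2 ≤ K) (n : ℕ) :
    ∀ T : Finset (Fin (Nat.choose (n + qsR K a b c n - 1) (qsR K a b c n))), T.card ≤ K →
      ∀ i ∈ T, ∃ x ∈ (qsPattern K a b c n).S i,
        ∀ j ∈ T, j ≠ i → x ∉ (qsPattern K a b c n).S j := by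
  by_cases hf : qsFits K a b c n = true
  · have hr : qsR K a b c n = 3 * qsRho K a b c n := if_pos hf
    have hD : qsPattern K a b c n = SoloPattern.subpattern n _ K := if_pos hf
    have hf' := (qsFits_iff K a b c n).1 hf
    rw [hD]
    refine SoloPattern.subpattern_privatePoints hK ?_ ?_ (Nat.le_pow_clog one_lt_two _)
    · rw [hr]; exact hf'.1
    · rw [SoloPattern.card_Pos, hr]; exact hf'.2
  · have hr : qsR K a b c n = 1 := if_neg hf
    have hD : qsPattern K a b c n = SoloPattern.idPattern n _ := if_neg hf
    rw [hD]
    have hmeq : Nat.choose (n + qsR K a b c n - 1) (qsR K a b c n) = n := by rw [hr]; simp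
    refine SoloPattern.idPattern_privatePoints hmeq.le ?_
    calc n ≤ 2 ^ Nat.clog 2 n := Nat.le_pow_clog one_lt_two n
      _ = _ := by rw [hmeq]

/-- **The design family**: `(K, h)`-designs of `C(n + r(n) - 1, r(n))` subsets of `Fin n`. -/
def qsDesign (h : ℕ) (hK : 2 ≤ K) (n : ℕ) :
    SoloDesign K h (Nat.choose (n + qsR K a b c n - 1) (qsR K a b c n)) n :=
  SoloDesign.ofPrivatePoints (fun i => (qsPattern K a b c n).S i) (qsPattern_privatePoints K a b c hK n)

/-- `⌈log₂ C(n + r(n) - 1, r(n))⌉` is polynomially bounded (indeed `≤ n + r(n) ≤ (3a+4)(n+1)`). -/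
theorem qs_clog_isPBounded :
    IsPBounded fun n => Nat.clog 2 (Nat.choose (n + qsR K a b c n - 1) (qsR K a b c n)) := by
  refine (IsPBounded.iff_exists_le_mul_succ_pow _).2 ⟨3 * a + 4, 1, fun n => ?_⟩
  have hτ : qsTau K a b c n ≤ n := (Nat.findGreatest_le _).trans (Nat.log_le_self 2 n)
  have hr : qsR K a b c n ≤ 3 * (a * n + 1) := by
    unfold qsR qsRho
    split_ifs
    · exact Nat.mul_le_mul_left 3 (Nat.add_le_add_right (Nat.mul_le_mul_left a hτ) 1)
    · omega
  calc Nat.clog 2 (Nat.choose (n + qsR K a b c n - 1) (qsR K a b c n)) ≤ n + qsR K a b c n - 1 :=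
        Nat.clog_le_of_le_pow (Nat.choose_le_two_pow _ _)
    _ ≤ n + qsR K a b c n := Nat.sub_le _ _
    _ ≤ (3 * a + 4) * (n + 1) ^ 1 := by rw [pow_one]; nlinarith [hr]

/-- **Definability** (Raz, Def. 1.3) of the design maps, with an empty Boolean sum. -/
theorem qs_isPolyDefinableMap (h : ℕ) (hK : 2 ≤ K) :
    IsPolyDefinableMap (m := fun n => Nat.choose (n + qsR K a b c n - 1) (qsR K a b c n))
      (σ := fun n => Fin n) fun n => soloDesignMap (qsDesign K a b c h hK n).S :=
  soloInformed_isPolyDefinableMap_pattern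
    (m := fun n => Nat.choose (n + qsR K a b c n - 1) (qsR K a b c n))
    (qsPattern K a b c) (qs_clog_isPBounded K a b c)

/-- Each summand of `W` is at most `W`. -/
theorem qsW_ge (τ : ℕ) :
    τ ≤ qsW K a b c τ ∧ 2 ^ K ≤ qsW K a b c τ ∧ 3 * (a * τ + 1) ≤ qsW K a b c τ ∧
      c * Nat.factorial (3 * (a * τ + 1)) ^ b ≤ qsW K a b c τ ∧
        (6 * (a * τ + 1)) ^ (K - 1) ≤ qsW K a b c τ := by
  have h2K : 1 ≤ 2 ^ K := Nat.one_le_two_pow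
  unfold qsW; omega

/-- Once `W(0) ≤ ⌊log₂ n⌋`: `W(τ(n)) ≤ ⌊log₂ n⌋`. -/
theorem qsW_tau_le {n : ℕ} (h0 : qsW K a b c 0 ≤ Nat.log 2 n) :
    qsW K a b c (qsTau K a b c n) ≤ Nat.log 2 n := by
  unfold qsTau
  exact Nat.findGreatest_spec (P := fun τ => qsW K a b c τ ≤ Nat.log 2 n) (Nat.zero_le _) h0

/-- `τ(n) ≥ T` as soon as `W(T) ≤ ⌊log₂ n⌋`. -/
theorem le_qsTau {n T : ℕ} (hT : qsW K a b c T ≤ Nat.log 2 n) : T ≤ qsTau K a b c n := by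
  unfold qsTau
  exact Nat.le_findGreatest (P := fun τ => qsW K a b c τ ≤ Nat.log 2 n)
    ((qsW_ge K a b c T).1.trans hT) hT

/-- **Eventually everything fits**: for large `n`, `n ≥ 1`, the subpattern design fits, and
`W(τ(n)) ≤ ⌊log₂ n⌋`. -/
theorem qs_eventually (hK : 2 ≤ K) : ∃ n₀ : ℕ, ∀ n ≥ n₀,
    1 ≤ n ∧ qsFits K a b c n = true ∧ qsW K a b c (qsTau K a b c n) ≤ Nat.log 2 n := by
  obtain ⟨T₁, hT₁⟩ := eventually_mul_pow_lt_two_pow K (2 ^ K)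
  refine ⟨2 ^ (qsW K a b c 0 + T₁ + K + 1), fun n hn => ?_⟩
  have hU : qsW K a b c 0 + T₁ + K + 1 ≤ Nat.log 2 n := Nat.le_log_of_pow_le one_lt_two hn
  have hn1 : 1 ≤ n := Nat.one_le_two_pow.trans hn
  have hW : qsW K a b c (qsTau K a b c n) ≤ Nat.log 2 n := qsW_tau_le K a b c (by omega)
  have hWge := qsW_ge K a b c (qsTau K a b c n)
  have hρ : qsRho K a b c n = a * qsTau K a b c n + 1 := rfl
  have hr'u : 3 * qsRho K a b c n ≤ Nat.log 2 n := by rw [hρ]; exact hWge.2.2.1.trans hW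
  have hm'n : n ≤ Nat.choose (n + 3 * qsRho K a b c n - 1) (3 * qsRho K a b c n) :=
    solo_le_choose_multiset n (by rw [hρ]; omega)
  have hm'le : Nat.choose (n + 3 * qsRho K a b c n - 1) (3 * qsRho K a b c n) ≤
      2 ^ ((Nat.log 2 n + 1) * (3 * qsRho K a b c n)) :=
    calc Nat.choose (n + 3 * qsRho K a b c n - 1) (3 * qsRho K a b c n)
        ≤ n ^ (3 * qsRho K a b c n) := choose_multiset_le_pow hn1 _
      _ ≤ (2 ^ (Nat.log 2 n + 1)) ^ (3 * qsRho K a b c n) :=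
          Nat.pow_le_pow_left (Nat.lt_pow_succ_log_self one_lt_two n).le _
      _ = 2 ^ ((Nat.log 2 n + 1) * (3 * qsRho K a b c n)) := (pow_mul _ _ _).symm
  have hL : qsL K a b c n ≤ (Nat.log 2 n + 1) * (3 * qsRho K a b c n) :=
    Nat.clog_le_of_le_pow hm'le
  have hL1 : K - 1 ≤ qsL K a b c n :=
    calc K - 1 = Nat.clog 2 (2 ^ (K - 1)) := (Nat.clog_pow 2 (K - 1) one_lt_two).symm
      _ ≤ Nat.clog 2 n :=
          Nat.clog_mono_right 2 ((Nat.pow_le_pow_right two_pos (by omega)).trans hn)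
      _ ≤ qsL K a b c n := Nat.clog_mono_right 2 hm'n
  refine ⟨hn1, (qsFits_iff K a b c n).2 ⟨hL1, ?_⟩, hW⟩ -- it remains: the positions fit
  have h6 : (6 * qsRho K a b c n) ^ (K - 1) ≤ Nat.log 2 n := by
    rw [hρ]; exact hWge.2.2.2.2.trans hW
  have hu1 : 1 ≤ Nat.log 2 n := by omega
  have huT : T₁ ≤ Nat.log 2 n := by omega
  have h2L : 2 * qsL K a b c n ≤ 6 * qsRho K a b c n * (Nat.log 2 n + 1) :=
    calc 2 * qsL K a b c n ≤ 2 * ((Nat.log 2 n + 1) * (3 * qsRho K a b c n)) :=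
          Nat.mul_le_mul_left 2 hL
      _ = 6 * qsRho K a b c n * (Nat.log 2 n + 1) := by ring
  calc Nat.choose (qsL K a b c n) (K - 1) * 2 ^ (K - 1)
      ≤ qsL K a b c n ^ (K - 1) * 2 ^ (K - 1) := Nat.mul_le_mul_right _ (Nat.choose_le_pow _ _)
    _ = (2 * qsL K a b c n) ^ (K - 1) := by rw [mul_pow, mul_comm]
    _ ≤ (6 * qsRho K a b c n * (Nat.log 2 n + 1)) ^ (K - 1) := Nat.pow_le_pow_left h2L _
    _ = (6 * qsRho K a b c n) ^ (K - 1) * (Nat.log 2 n + 1) ^ (K - 1) := mul_pow _ _ _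
    _ ≤ Nat.log 2 n * (Nat.log 2 n + 1) ^ (K - 1) := Nat.mul_le_mul_right _ h6
    _ ≤ (Nat.log 2 n + 1) * (Nat.log 2 n + 1) ^ (K - 1) :=
        Nat.mul_le_mul_right _ (Nat.le_succ _)
    _ = (Nat.log 2 n + 1) ^ (K - 1 + 1) := (pow_succ' _ _).symm
    _ = (Nat.log 2 n + 1) ^ K := by rw [Nat.sub_add_cancel (by omega : 1 ≤ K)]
    _ ≤ (2 * Nat.log 2 n) ^ K := Nat.pow_le_pow_left (by omega) _
    _ = 2 ^ K * Nat.log 2 n ^ K := mul_pow _ _ _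
    _ ≤ 2 ^ Nat.log 2 n := (hT₁ _ huT).le
    _ ≤ n := Nat.pow_log_le_self 2 (by omega)

end Params

/-- **Conjecture Q* ⟹ `VP ℂ ≠ VNP ℂ`, with every side condition discharged** (exponent form).
If a univariate quadratic-span bound structure `B : SoloQuadSpanBound K h` (`K ≥ 2`, `h ≥ 1`)
has `B.Q s ^ b ≤ c · s ^ a` for all large `s`, with `2a < 3b`, then `VP ℂ ≠ VNP ℂ`.  The designs,
the parameters `r, s` and the definability witness are the explicit ones of this file; Raz 2010,
Cor. 5.8 is invoked through `soloInformed_vp_ne_vnp_of_quadSpanBound_cor58`.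
[cite: Raz2010, Cor. 5.8 = Cor. 1.14, Defs. 1.1, 1.3] -/
theorem soloInformed_vp_ne_vnp_of_quadSpanBound_exponent {K h : ℕ} (hK : 2 ≤ K) (hh : 1 ≤ h)
    (B : SoloQuadSpanBound K h) {a b c s₀ : ℕ} (hab : 2 * a < 3 * b)
    (hQ : ∀ s : ℕ, s₀ ≤ s → B.Q s ^ b ≤ c * s ^ a) : VP ℂ ≠ VNP ℂ := by
  obtain ⟨n₀, hn₀⟩ := qs_eventually K a b c hK
  refine soloInformed_vp_ne_vnp_of_quadSpanBound_cor58 hK hh B (r := qsR K a b c)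
    (s := qsS K a b c) (qsDesign K a b c h hK) ?_ ?_ ?_ (qs_isPolyDefinableMap K a b c h hK)
  · refine ⟨n₀, fun n hn => ?_⟩ -- Raz's parameter conditions `3 ≤ r ≤ n ≤ s`
    obtain ⟨hn1, hf, hW⟩ := hn₀ n hn
    have hr : qsR K a b c n = 3 * qsRho K a b c n := if_pos hf
    have hWge := qsW_ge K a b c (qsTau K a b c n)
    have hρ : qsRho K a b c n = a * qsTau K a b c n + 1 := rfl
    refine ⟨?_, ?_, ?_⟩
    · rw [hr, hρ]; omega
    · rw [hr, hρ]; exact hWge.2.2.1.trans (hW.trans (Nat.log_le_self 2 n))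
    · exact Nat.le_self_pow (by rw [hρ]; omega) n
  · intro c₀ -- growth: `n^{c₀} · C(n + 2ρ - 1, 2ρ) ≤ n^{c₀ + 2ρ} ≤ n^{2ρ + τ} = s`
    refine ⟨max n₀ (2 ^ qsW K a b c c₀), fun n hn => ?_⟩
    obtain ⟨hn1, hf, -⟩ := hn₀ n ((le_max_left _ _).trans hn)
    have hr : qsR K a b c n = 3 * qsRho K a b c n := if_pos hf
    have hτ : c₀ ≤ qsTau K a b c n :=
      le_qsTau K a b c (Nat.le_log_of_pow_le one_lt_two ((le_max_right _ _).trans hn))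
    rw [hr, show 2 * (3 * qsRho K a b c n) / 3 = 2 * qsRho K a b c n by omega]
    unfold qsS
    calc n ^ c₀ * Nat.choose (n + 2 * qsRho K a b c n - 1) (2 * qsRho K a b c n)
        ≤ n ^ c₀ * n ^ (2 * qsRho K a b c n) :=
          Nat.mul_le_mul_left _ (choose_multiset_le_pow hn1 _)
      _ = n ^ (c₀ + 2 * qsRho K a b c n) := (pow_add _ _ _).symm
      _ ≤ n ^ (2 * qsRho K a b c n + qsTau K a b c n) := Nat.pow_le_pow_right hn1 (by omega)
  · refine ⟨max n₀ s₀, fun n hn => ?_⟩ -- the bound beats the arity: `B.Q (s n) < C(n+r-1, r)`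
    obtain ⟨hn1, hf, hW⟩ := hn₀ n ((le_max_left _ _).trans hn)
    have hr : qsR K a b c n = 3 * qsRho K a b c n := if_pos hf
    have hWge := qsW_ge K a b c (qsTau K a b c n)
    have hlog : Nat.log 2 n < n := Nat.log_lt_self 2 (by omega)
    rw [hr]; unfold qsS qsRho; set τ := qsTau K a b c n with hτdef
    obtain ⟨d₁, hd₁⟩ : ∃ d₁, 3 * b = 2 * a + 1 + d₁ := ⟨3 * b - (2 * a + 1), by omega⟩
    have hident : (2 * (a * τ + 1) + τ) * a + (a * τ * d₁ + d₁ + 1) = 3 * (a * τ + 1) * b := by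
      rw [show 3 * (a * τ + 1) * b = (a * τ + 1) * (3 * b) by ring, hd₁]; ring
    by_contra hle; push Not at hle
    have hs₀ : s₀ ≤ n ^ (2 * (a * τ + 1) + τ) :=
      ((le_max_right _ _).trans hn).trans (Nat.le_self_pow (by omega) n)
    have hQ' := hQ _ hs₀
    have h1 : n ^ (3 * (a * τ + 1)) ≤
        Nat.factorial (3 * (a * τ + 1)) * Nat.choose (n + 3 * (a * τ + 1) - 1) (3 * (a * τ + 1)) :=
      solo_pow_le_factorial_mul_choose_multiset n _
    have h2 : n ^ (3 * (a * τ + 1) * b) ≤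
        Nat.factorial (3 * (a * τ + 1)) ^ b * (c * (n ^ (2 * (a * τ + 1) + τ)) ^ a) :=
      calc n ^ (3 * (a * τ + 1) * b) = (n ^ (3 * (a * τ + 1))) ^ b := pow_mul _ _ _
        _ ≤ (Nat.factorial (3 * (a * τ + 1)) *
              Nat.choose (n + 3 * (a * τ + 1) - 1) (3 * (a * τ + 1))) ^ b :=
            Nat.pow_le_pow_left h1 _
        _ = Nat.factorial (3 * (a * τ + 1)) ^ b *
              Nat.choose (n + 3 * (a * τ + 1) - 1) (3 * (a * τ + 1)) ^ b := mul_pow _ _ _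
        _ ≤ Nat.factorial (3 * (a * τ + 1)) ^ b * B.Q (n ^ (2 * (a * τ + 1) + τ)) ^ b :=
            Nat.mul_le_mul_left _ (Nat.pow_le_pow_left hle _)
        _ ≤ Nat.factorial (3 * (a * τ + 1)) ^ b * (c * (n ^ (2 * (a * τ + 1) + τ)) ^ a) :=
            Nat.mul_le_mul_left _ hQ'
    have h3 : n ^ ((2 * (a * τ + 1) + τ) * a) * n ≤ n ^ (3 * (a * τ + 1) * b) := by
      rw [← hident, pow_add]; exact Nat.mul_le_mul_left _ (Nat.le_self_pow (by omega) n)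
    have h4 : n ^ ((2 * (a * τ + 1) + τ) * a) * n ≤
        n ^ ((2 * (a * τ + 1) + τ) * a) * (Nat.factorial (3 * (a * τ + 1)) ^ b * c) :=
      calc n ^ ((2 * (a * τ + 1) + τ) * a) * n ≤ n ^ (3 * (a * τ + 1) * b) := h3
        _ ≤ Nat.factorial (3 * (a * τ + 1)) ^ b * (c * (n ^ (2 * (a * τ + 1) + τ)) ^ a) := h2
        _ = n ^ ((2 * (a * τ + 1) + τ) * a) * (Nat.factorial (3 * (a * τ + 1)) ^ b * c) := by
            rw [← pow_mul]; ring
    have h5 : n ≤ Nat.factorial (3 * (a * τ + 1)) ^ b * c :=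
      Nat.le_of_mul_le_mul_left h4 (by positivity)
    have h6 : c * Nat.factorial (3 * (a * τ + 1)) ^ b < n :=
      lt_of_le_of_lt (hWge.2.2.2.1.trans hW) hlog
    linarith [h5, h6]

/-- **Conjecture Q* ⟹ `VP ℂ ≠ VNP ℂ`** (real-exponent form): if `B.Q s ≤ C · s^γ` for all large
`s` with some real `γ < 3/2`, then `VP ℂ ≠ VNP ℂ`. [cite: Raz2010, Cor. 5.8 = Cor. 1.14] -/
theorem soloInformed_vp_ne_vnp_of_quadSpanBound_rpow {K h : ℕ} (hK : 2 ≤ K) (hh : 1 ≤ h)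
    (B : SoloQuadSpanBound K h) {γ C : ℝ} (hγ : γ < 3 / 2) {s₀ : ℕ}
    (hQ : ∀ s : ℕ, s₀ ≤ s → (B.Q s : ℝ) ≤ C * (s : ℝ) ^ γ) : VP ℂ ≠ VNP ℂ := by
  set γ' := max γ 0 with hγ' -- exponents `a / b` with `γ' ≤ a / b` and `2a < 3b`
  have hγ'0 : 0 ≤ γ' := le_max_right _ _
  have hγ'lt : γ' < 3 / 2 := max_lt hγ (by norm_num)
  have hpos : 0 < 3 - 2 * γ' := by linarith
  obtain ⟨b, hb⟩ := exists_nat_gt (2 / (3 - 2 * γ'))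
  have hb2 : 2 < (b : ℝ) * (3 - 2 * γ') := (div_lt_iff₀ hpos).1 hb
  have hb0r : (0 : ℝ) < b := lt_trans (by positivity) hb
  have hb0 : 0 < b := by exact_mod_cast hb0r
  set a := ⌈γ' * b⌉₊ with ha
  have ha1 : γ' * b ≤ a := Nat.le_ceil _
  have ha2 : (a : ℝ) < γ' * b + 1 := Nat.ceil_lt_add_one (by positivity)
  have hab : 2 * a < 3 * b := by exact_mod_cast (by linarith : (2 * a : ℝ) < 3 * b)
  set C' := max C 0 with hC'
  have hC'0 : 0 ≤ C' := le_max_right _ _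
  refine soloInformed_vp_ne_vnp_of_quadSpanBound_exponent hK hh B (a := a) (b := b)
    (c := ⌈C' ^ b⌉₊) (s₀ := max s₀ 1) hab fun s hs => ?_
  have hs1 : (1 : ℝ) ≤ s := by exact_mod_cast (le_max_right _ _).trans hs
  have hs0 : (0 : ℝ) ≤ s := by positivity
  have hγab : γ ≤ (a : ℝ) / b :=
    calc γ ≤ γ' := le_max_left _ _
      _ ≤ (a : ℝ) / b := by rw [le_div_iff₀ hb0r]; exact ha1
  have h1 : (B.Q s : ℝ) ≤ C' * (s : ℝ) ^ ((a : ℝ) / b) :=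
    calc (B.Q s : ℝ) ≤ C * (s : ℝ) ^ γ := hQ s ((le_max_left _ _).trans hs)
      _ ≤ C' * (s : ℝ) ^ γ := mul_le_mul_of_nonneg_right (le_max_left _ _) (by positivity)
      _ ≤ C' * (s : ℝ) ^ ((a : ℝ) / b) :=
          mul_le_mul_of_nonneg_left (Real.rpow_le_rpow_of_exponent_le hs1 hγab) hC'0
  have h2 : ((B.Q s : ℝ)) ^ b ≤ C' ^ b * (s : ℝ) ^ a :=
    calc ((B.Q s : ℝ)) ^ b ≤ (C' * (s : ℝ) ^ ((a : ℝ) / b)) ^ b :=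
          pow_le_pow_left₀ (by positivity) h1 b
      _ = C' ^ b * ((s : ℝ) ^ ((a : ℝ) / b)) ^ b := mul_pow _ _ _
      _ = C' ^ b * (s : ℝ) ^ a := by
          congr 1
          rw [← Real.rpow_natCast ((s : ℝ) ^ ((a : ℝ) / b)) b, ← Real.rpow_mul hs0,
            div_mul_cancel₀ (a : ℝ) hb0r.ne', Real.rpow_natCast]
  have h3 : ((B.Q s ^ b : ℕ) : ℝ) ≤ ((⌈C' ^ b⌉₊ * s ^ a : ℕ) : ℝ) := by
    push_cast
    calc ((B.Q s : ℝ)) ^ b ≤ C' ^ b * (s : ℝ) ^ a := h2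
      _ ≤ (⌈C' ^ b⌉₊ : ℝ) * (s : ℝ) ^ a :=
          mul_le_mul_of_nonneg_right (Nat.le_ceil _) (by positivity)
  exact_mod_cast h3

/-- **Conjecture Q* ⟹ `VP ℂ ≠ VNP ℂ`** (`IsBigO` form): `B.Q = O(s^γ)` with `γ < 3/2` gives
`VP ℂ ≠ VNP ℂ`. [cite: Raz2010, Cor. 5.8 = Cor. 1.14] -/
theorem soloInformed_vp_ne_vnp_of_quadSpanBound_isBigO {K h : ℕ} (hK : 2 ≤ K) (hh : 1 ≤ h)
    (B : SoloQuadSpanBound K h) {γ : ℝ} (hγ : γ < 3 / 2)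
    (hQ : (fun s : ℕ => (B.Q s : ℝ)) =O[Filter.atTop] fun s : ℕ => (s : ℝ) ^ γ) :
    VP ℂ ≠ VNP ℂ := by
  obtain ⟨C, hC⟩ := hQ.bound
  obtain ⟨s₀, hs₀⟩ := Filter.eventually_atTop.1 hC
  refine soloInformed_vp_ne_vnp_of_quadSpanBound_rpow hK hh B hγ (C := C) (s₀ := s₀)
    fun s hs => ?_
  simpa [Real.norm_natCast, Real.norm_of_nonneg (Real.rpow_nonneg (Nat.cast_nonneg s) γ)] using hs₀ s hs

/-- **Conjecture Q* ⟹ Valiant's hypothesis** (the summit constant `ValiantsHypothesis`, i.e.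
`VP ℂ ≠ VNP ℂ`): a univariate quadratic-span bound structure for some order `K ≥ 2` and height
`h ≥ 1` whose bound is `O(s^γ)` with `γ < 3/2` implies the summit.  This is the implication
only; the bound structure is a hypothesis (Conjecture Q* is open).
[cite: Raz2010, Cor. 5.8 = Cor. 1.14] -/
theorem soloInformed_valiantsHypothesis_of_quadSpanBound {K h : ℕ} (hK : 2 ≤ K) (hh : 1 ≤ h)
    (B : SoloQuadSpanBound K h) {γ : ℝ} (hγ : γ < 3 / 2)
    (hQ : (fun s : ℕ => (B.Q s : ℝ)) =O[Filter.atTop] fun s : ℕ => (s : ℝ) ^ γ) :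
    ValiantsHypothesis :=
  soloInformed_vp_ne_vnp_of_quadSpanBound_isBigO hK hh B hγ hQ

end Summit.ValiantsHypothesis.ValiantsHypothesis.Theorems
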